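import Mathlib.MeasureTheory.Integral.IntervalIntegral.FundThmCalculus
import Mathlib.MeasureTheory.Function.ContinuousMapDense
import Mathlib.Analysis.SpecialFunctions.ExpDeriv
import HarnessLib

/-!
# A Grönwall comparison with an integrable rate: `f' ≤ ṙ f`, `f ≥ 0` ⟹ `f(b) ≤ f(a) e^{∫ ṙ}`
# (the step `ψ′(s) ≤ 0 ⟹ ψ(t) ≤ ψ(0)` of Bauerschmidt–Bodineau–Dagallier's proof of Theorem 3)

Topic `Literature/Analysis/FunctionSpaces`; "proof architecture" file behind the named fact
`Polchinski.BauerschmidtBodineau_multiscaleBakryEmery` ([BBD] Theorem 3, `MultiscaleBakryEmery.lean`).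
In [BBD]'s proof (p0016 L120–123) the differential inequality
`(L_s − ∂_s)(∇√P_{0,s}F)²_{Ċ_s} ≥ 2λ̇_s(∇√P_{0,s}F)²_{Ċ_s}` is integrated in the form
«`ψ(s) := e^{−2λ_t+2λ_s} P_{s,t}[(∇√P_{0,s}F)²_{Ċ_s}]` satisfies `ψ′(s) ≤ 0` for `s < t`, hence
`ψ(t) ≤ ψ(0)`», with `λ_t = ∫₀^t λ̇_s ds`.  In the typed Theorem 3 the rate `λ̇` is only assumed locally
integrable (not continuous), so `λ` is merely absolutely continuous and the product `e^{2λ_s}·(…)` is not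
differentiable; this file proves the needed comparison principle in that generality: if `f ≥ 0` is
continuous on `[a,b]`, differentiable on `(a,b)` with `f′ ≤ ṙ f` there, and `ṙ` is integrable on `[a,b]`,
then `f(b) ≤ f(a) exp(∫_a^b ṙ)`.  Proof: approximate `ṙ` in `L¹[a,b]` by a continuous `c`
(`Integrable.exists_boundedContinuous_integral_sub_le`), apply the fundamental-theorem inequality
`g(b) − g(a) ≤ ∫ φ` (`intervalIntegral.sub_le_integral_of_hasDeriv_right_of_le`) to
`g = f·e^{−∫_a^· c}` with `g′ ≤ |ṙ − c|·(sup f)·e^{∫|c|}`, and let the `L¹` error tend to `0`.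

## Main results (sorry-free; no new definitions, no new named facts)

* `le_mul_exp_integral_of_hasDerivAt_le` — the comparison `f(b) ≤ f(a)·exp(∫_a^b ṙ)`.

Nothing here concerns Yang–Mills.

## References

* [BauerschmidtBodineauDagallier2023] R. Bauerschmidt, T. Bodineau, B. Dagallier, Probab. Surveys 21
  (2024) 200–290, arXiv:2307.07619 — proof of Theorem 3, p0016 L120–123. READ (held text).
-/

noncomputable section

open MeasureTheory Set Filter Topology intervalIntegral

namespace Literature.Analysis.FunctionSpaces

namespace Polchinski

/-- One step of the comparison: for a CONTINUOUS approximant `c` of the rate, with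
`E(x) = exp(−∫_a^x c)`, the function `g = f·E` satisfies `g(b) − g(a) ≤ K·L·∫_a^b |ṙ − c|` whenever
`0 ≤ f ≤ K` and `E ≤ L` on `[a,b]`. [cite: BauerschmidtBodineauDagallier2023, Theorem 3 (proof)] -/
private theorem comparison_step {f f' r : ℝ → ℝ} {a b : ℝ} (hab : a ≤ b)
    (hfc : ContinuousOn f (Icc a b)) (hf : ∀ x ∈ Ioo a b, HasDerivAt f (f' x) x)
    (hf0 : ∀ x ∈ Icc a b, 0 ≤ f x) (hr : IntegrableOn r (Icc a b))
    (hle : ∀ x ∈ Ioo a b, f' x ≤ r x * f x) {K : ℝ} (hK : ∀ x ∈ Icc a b, f x ≤ K)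
    {c : ℝ → ℝ} (hc : Continuous c) {L : ℝ}
    (hL : ∀ x ∈ Icc a b, Real.exp (-∫ t in a..x, c t) ≤ L) :
    f b * Real.exp (-∫ t in a..b, c t) - f a ≤ K * L * ∫ t in a..b, |r t - c t| := by
  -- the integrating factor and its derivative
  set E : ℝ → ℝ := fun x => Real.exp (-∫ t in a..x, c t) with hE
  have hEd : ∀ x, HasDerivAt E (-c x * E x) x := by
    intro x
    have h1 : HasDerivAt (fun x => ∫ t in a..x, c t) (c x) x :=
      (hc.integral_hasStrictDerivAt a x).hasDerivAt
    have h2 := h1.neg.exp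
    refine h2.congr_deriv ?_
    simp only [hE, Pi.neg_apply]; ring
  have hEc : Continuous E := continuous_iff_continuousAt.2 fun x => (hEd x).continuousAt
  have hEpos : ∀ x, 0 < E x := fun x => Real.exp_pos _
  -- `g = f E`
  have hgc : ContinuousOn (fun x => f x * E x) (Icc a b) := hfc.mul hEc.continuousOn
  have hgd : ∀ x ∈ Ioo a b,
      HasDerivWithinAt (fun x => f x * E x) (f' x * E x + f x * (-c x * E x)) (Ioi x) x :=
    fun x hx => ((hf x hx).mul (hEd x)).hasDerivWithinAt
  -- integrability of the majorant
  have hK0 : 0 ≤ K := le_trans (hf0 a (left_mem_Icc.2 hab)) (hK a (left_mem_Icc.2 hab))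
  have hL0 : 0 ≤ L := le_trans (Real.exp_pos _).le (hL a (left_mem_Icc.2 hab))
  have hci : IntegrableOn c (Icc a b) := hc.continuousOn.integrableOn_compact isCompact_Icc
  have hrc : IntegrableOn (fun t => |r t - c t|) (Icc a b) := (hr.sub hci).abs
  have hφ : IntegrableOn (fun t => K * L * |r t - c t|) (Icc a b) := hrc.const_mul _
  -- the pointwise bound `g' ≤ K L |ṙ − c|`
  have hbound : ∀ x ∈ Ioo a b, f' x * E x + f x * (-c x * E x) ≤ K * L * |r x - c x| := by
    intro x hx
    have hxI : x ∈ Icc a b := Ioo_subset_Icc_self hx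
    have hEx := hEpos x
    have h1 : f' x * E x ≤ r x * f x * E x := mul_le_mul_of_nonneg_right (hle x hx) hEx.le
    have h2 : f' x * E x + f x * (-c x * E x) ≤ (r x - c x) * (f x * E x) := by nlinarith
    have h3 : (r x - c x) * (f x * E x) ≤ |r x - c x| * (f x * E x) :=
      mul_le_mul_of_nonneg_right (le_abs_self _) (mul_nonneg (hf0 x hxI) hEx.le)
    have h4 : |r x - c x| * (f x * E x) ≤ |r x - c x| * (K * L) :=
      mul_le_mul_of_nonneg_left (mul_le_mul (hK x hxI) (hL x hxI) hEx.le hK0) (abs_nonneg _)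
    linarith
  have hmain := intervalIntegral.sub_le_integral_of_hasDeriv_right_of_le hab hgc hgd hφ hbound
  -- evaluate
  have hEa : E a = 1 := by simp [hE]
  simp only [hEa, mul_one] at hmain
  rw [intervalIntegral.integral_const_mul] at hmain
  exact hmain

/-- **Grönwall comparison with an integrable rate** (the integration step of [BBD]'s proof of
Theorem 3, «`ψ′(s) ≤ 0` … implies `ψ(t) ≤ ψ(0)`», p0016 L120–123, in the generality of a merely
integrable rate `λ̇`): if `f` is continuous and nonnegative on `[a,b]`, differentiable on `(a,b)` with
`f′(x) ≤ ṙ(x) f(x)`, and `ṙ` is integrable on `[a,b]`, then `f(b) ≤ f(a)·exp(∫_a^b ṙ)`.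
[cite: BauerschmidtBodineauDagallier2023, Theorem 3 (proof)] -/
theorem le_mul_exp_integral_of_hasDerivAt_le {f f' r : ℝ → ℝ} {a b : ℝ} (hab : a ≤ b)
    (hfc : ContinuousOn f (Icc a b)) (hf : ∀ x ∈ Ioo a b, HasDerivAt f (f' x) x)
    (hf0 : ∀ x ∈ Icc a b, 0 ≤ f x) (hr : IntegrableOn r (Icc a b))
    (hle : ∀ x ∈ Ioo a b, f' x ≤ r x * f x) :
    f b ≤ f a * Real.exp (∫ x in a..b, r x) := by
  -- a bound on `f`
  obtain ⟨K, hK⟩ := isCompact_Icc.exists_bound_of_continuousOn hfc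
  have hK' : ∀ x ∈ Icc a b, f x ≤ K := fun x hx => by
    have h := hK x hx
    rw [Real.norm_eq_abs] at h
    exact (le_abs_self _).trans h
  have hK0 : 0 ≤ K := le_trans (hf0 a (left_mem_Icc.2 hab)) (hK' a (left_mem_Icc.2 hab))
  set I : ℝ := ∫ x in a..b, r x with hI
  set J : ℝ := ∫ x in a..b, |r x| with hJ
  set L : ℝ := Real.exp (J + 1) with hLdef
  -- it suffices to prove the bound up to an arbitrary `η > 0`
  refine le_of_forall_pos_le_add fun η hη => ?_
  -- choice of the `L¹` tolerance `δ`
  set Φ : ℝ → ℝ := fun δ => (f a + K * L * δ) * Real.exp δ * Real.exp I with hΦ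
  have hΦc : Continuous Φ := by
    simp only [hΦ]
    fun_prop
  have hΦ0 : Φ 0 = f a * Real.exp I := by simp [hΦ]
  have hev : ∀ᶠ δ in 𝓝 (0 : ℝ), Φ δ < f a * Real.exp I + η := by
    have ht : Tendsto Φ (𝓝 0) (𝓝 (Φ 0)) := hΦc.tendsto 0
    rw [hΦ0] at ht
    exact ht.eventually (gt_mem_nhds (by linarith))
  obtain ⟨ε, hε, hεΦ⟩ := Metric.eventually_nhds_iff.1 hev
  set δ : ℝ := min (ε / 2) 1 with hδ
  have hδpos : 0 < δ := by positivity
  have hδ1 : δ ≤ 1 := min_le_right _ _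
  have hδε : dist δ 0 < ε := by
    rw [dist_zero_right, Real.norm_eq_abs, abs_of_pos hδpos]
    exact lt_of_le_of_lt (min_le_left _ _) (by linarith)
  have hΦδ : Φ δ < f a * Real.exp I + η := hεΦ hδε
  -- continuous `L¹` approximation of the rate on `[a,b]`
  set μ : Measure ℝ := volume.restrict (Icc a b) with hμ
  haveI : μ.WeaklyRegular :=
    Measure.WeaklyRegular.restrict_of_measure_ne_top (by simp [Real.volume_Icc])
  have hrμ : Integrable r μ := hr
  obtain ⟨c, hc1, -⟩ := hrμ.exists_boundedContinuous_integral_sub_le hδpos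
  have hcc : Continuous (c : ℝ → ℝ) := c.continuous
  have hci : IntegrableOn (c : ℝ → ℝ) (Icc a b) :=
    hcc.continuousOn.integrableOn_compact isCompact_Icc
  -- `∫_a^b |ṙ − c| ≤ δ`
  have hD : ∫ t in a..b, |r t - c t| ≤ δ := by
    rw [intervalIntegral.integral_of_le hab, ← integral_Icc_eq_integral_Ioc]
    have : ∫ t in Icc a b, |r t - c t| = ∫ x, ‖r x - c x‖ ∂μ := by
      simp only [hμ, Real.norm_eq_abs]
    rw [this]
    exact hc1
  have hD0 : 0 ≤ ∫ t in a..b, |r t - c t| :=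
    intervalIntegral.integral_nonneg hab fun t _ => abs_nonneg _
  -- interval integrability facts
  have hri : IntervalIntegrable r volume a b :=
    (intervalIntegrable_iff_integrableOn_Ioc_of_le hab).2 (hr.mono_set Ioc_subset_Icc_self)
  have hcii : IntervalIntegrable (c : ℝ → ℝ) volume a b := hcc.intervalIntegrable a b
  have habsc : IntervalIntegrable (fun t => |(c : ℝ → ℝ) t|) volume a b := hcii.abs
  have habsr : IntervalIntegrable (fun t => |r t|) volume a b := hri.abs
  have habsrc : IntervalIntegrable (fun t => |r t - c t|) volume a b := (hri.sub hcii).abs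
  -- `∫_a^b |c| ≤ J + δ`
  have hJc : ∫ t in a..b, |(c : ℝ → ℝ) t| ≤ J + δ := by
    have h1 : ∫ t in a..b, |(c : ℝ → ℝ) t| ≤ ∫ t in a..b, (|r t| + |r t - c t|) := by
      refine intervalIntegral.integral_mono_on hab habsc (habsr.add habsrc) fun t _ => ?_
      have := abs_sub_abs_le_abs_sub (c t) (r t)
      rw [abs_sub_comm] at this
      linarith
    rw [intervalIntegral.integral_add habsr habsrc] at h1
    linarith
  -- the integrating factor is bounded by `L` on `[a,b]`
  have hL : ∀ x ∈ Icc a b, Real.exp (-∫ t in a..x, (c : ℝ → ℝ) t) ≤ L := by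
    intro x hx
    rw [hLdef]
    refine Real.exp_le_exp.2 ?_
    have h1 : -∫ t in a..x, (c : ℝ → ℝ) t ≤ ∫ t in a..x, |(c : ℝ → ℝ) t| := by
      rw [← intervalIntegral.integral_neg]
      refine intervalIntegral.integral_mono_on hx.1 (hcc.intervalIntegrable a x).neg
        ((hcc.intervalIntegrable a x).abs) fun t _ => ?_
      exact (neg_le_abs _)
    have h2 : ∫ t in a..x, |(c : ℝ → ℝ) t| ≤ ∫ t in a..b, |(c : ℝ → ℝ) t| :=
      intervalIntegral.integral_mono_interval le_rfl hx.1 hx.2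
        (Eventually.of_forall fun t => abs_nonneg _) habsc
    linarith
  -- the comparison step
  have hstep := comparison_step hab hfc hf hf0 hr hle hK' hcc hL
  -- `∫_a^b c ≤ I + δ`
  have hIc : -(∫ t in a..b, (c : ℝ → ℝ) t) ≥ -(I + δ) := by
    have h1 : (∫ t in a..b, (c : ℝ → ℝ) t) - I = ∫ t in a..b, (c t - r t) := by
      rw [hI, ← intervalIntegral.integral_sub hcii hri]
    have h2 : |∫ t in a..b, (c t - r t)| ≤ ∫ t in a..b, |c t - r t| :=
      intervalIntegral.abs_integral_le_integral_abs hab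
    have h3 : ∫ t in a..b, |c t - r t| = ∫ t in a..b, |r t - c t| := by
      refine intervalIntegral.integral_congr fun t _ => ?_
      exact abs_sub_comm _ _
    have h4 := le_abs_self (∫ t in a..b, (c t - r t))
    linarith
  -- assemble: `f b ≤ (f a + K L δ) e^{I + δ} = Φ δ`
  have hEb : 0 < Real.exp (-∫ t in a..b, (c : ℝ → ℝ) t) := Real.exp_pos _
  have hKL : 0 ≤ K * L := mul_nonneg hK0 (by rw [hLdef]; exact (Real.exp_pos _).le)
  have h1 : f b * Real.exp (-∫ t in a..b, (c : ℝ → ℝ) t) ≤ f a + K * L * δ := by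
    have := mul_le_mul_of_nonneg_left hD hKL
    linarith
  have h2 : f b ≤ (f a + K * L * δ) * Real.exp (∫ t in a..b, (c : ℝ → ℝ) t) := by
    have he : f b = (f b * Real.exp (-∫ t in a..b, (c : ℝ → ℝ) t)) *
        Real.exp (∫ t in a..b, (c : ℝ → ℝ) t) := by
      rw [mul_assoc, ← Real.exp_add, neg_add_cancel, Real.exp_zero, mul_one]
    rw [he]
    exact mul_le_mul_of_nonneg_right h1 (Real.exp_pos _).le
  have hfa0 : 0 ≤ f a + K * L * δ := by
    have := hf0 a (left_mem_Icc.2 hab)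
    positivity
  have hexp : Real.exp (∫ t in a..b, (c : ℝ → ℝ) t) ≤ Real.exp δ * Real.exp I := by
    rw [← Real.exp_add]
    exact Real.exp_le_exp.2 (by linarith [hIc])
  have hΦ' : Φ δ = (f a + K * L * δ) * (Real.exp δ * Real.exp I) := by
    simp only [hΦ]; ring
  have h3 : (f a + K * L * δ) * Real.exp (∫ t in a..b, (c : ℝ → ℝ) t) ≤ Φ δ := by
    rw [hΦ']
    exact mul_le_mul_of_nonneg_left hexp hfa0
  linarith

end Polchinski

end Literature.Analysis.FunctionSpaces

end
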